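import Summits.Schanuel.Schanuel.Theorems.RootDecomp1KHyper15

/-!
# RootDecomp1KHyper — part 16 of the «HyperCarving» port wave (lens 6, gen 9 = ROUND 4 of route-Schanuel-RootDecomp1K; 19 parts planned)

Mechanical port (census-1 gen 7, dependency closure; tools census/tools/gen7/portkit2.py + build_l6g9.py) of §17 of HOME/decomp-schanuel-lens-6/g9/HyperCarving.lean
(sha256 aba5c91f…, 8041 l; critic CLEARED FOR TYPING 2026-08-30T13:33:07Z; writer PATH A″ rev 5–8) together with the §§0–16 declarations it depends on
(nothing of the node was in the tree before except RootDecomp1KLinLiouvilleSplit and the Literature fact NesterenkoWaldschmidt1996_thm_5_1).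
This part: node lines 6845–7061 (22 declarations: hyperLiouvilleSchanuel_of_linLiouvilleSchanuel, finiteOrderLiouvilleSchanuel_of_linLiouvilleSchanuel, hyperLiouvilleSchanuel_of_schanuel, finiteOrderLiouvilleSchanuel_of_schanuel, linLiouvilleSchanuel_iff_pieces₄, schanuel_iff_pieces₄ …).
All parts share the namespace `Summit.Schanuel.Schanuel.Theorems.RootDecomp1KHyper` (node sub-namespace `HyperCell` reproduced); statements and proofs
are the node's verbatim; `--supports stmt-Schanuel-33363` (A₄ʰ HyperLiouvilleSchanuel). Sorry-free; standard axioms. Nothing here proves Schanuel; rung 0.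
-/

set_option linter.dupNamespace false
set_option linter.unusedSectionVars false

noncomputable section

open Complex IntermediateField Filter Polynomial

namespace Summit.Schanuel.Schanuel.Theorems.RootDecomp1KHyper

variable {n K : ℕ}

namespace HyperCell

variable {n K : ℕ}

/-- `exp(−x) ≤ 1/x` for `x > 0`. -/
private theorem exp_neg_le_one_div {x : ℝ} (hx : 0 < x) : Real.exp (-x) ≤ 1 / x := by
  rw [Real.exp_neg, ← one_div]
  exact one_div_le_one_div_of_le hx (by linarith [Real.add_one_le_exp x])

/-- §17f. ROUND 4 — the pieces A₄ʰ / A₄ᵈ of A₃, the glue, the node closes₅, exactness: auxiliary statement `hyperLiouvilleSchanuel_of_linLiouvilleSchanuel` (lens 6 gen 9 node, ported verbatim). -/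
theorem hyperLiouvilleSchanuel_of_linLiouvilleSchanuel (h : LinLiouvilleSchanuel) :
    HyperLiouvilleSchanuel :=
  fun n z hz hH => h n z hz (HyperLinLiouville.linLiouville hH)

/-- §17f. ROUND 4 — the pieces A₄ʰ / A₄ᵈ of A₃, the glue, the node closes₅, exactness: auxiliary statement `finiteOrderLiouvilleSchanuel_of_linLiouvilleSchanuel` (lens 6 gen 9 node, ported verbatim). -/
theorem finiteOrderLiouvilleSchanuel_of_linLiouvilleSchanuel (h : LinLiouvilleSchanuel) :
    FiniteOrderLiouvilleSchanuel :=
  fun n z hz hL _ => h n z hz hL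

/-- §17f. ROUND 4 — the pieces A₄ʰ / A₄ᵈ of A₃, the glue, the node closes₅, exactness: auxiliary statement `hyperLiouvilleSchanuel_of_schanuel` (lens 6 gen 9 node, ported verbatim). -/
theorem hyperLiouvilleSchanuel_of_schanuel (h : _root_.Schanuel) : HyperLiouvilleSchanuel :=
  fun n z hz _ => h n z hz

/-- §17f. ROUND 4 — the pieces A₄ʰ / A₄ᵈ of A₃, the glue, the node closes₅, exactness: auxiliary statement `finiteOrderLiouvilleSchanuel_of_schanuel` (lens 6 gen 9 node, ported verbatim). -/
theorem finiteOrderLiouvilleSchanuel_of_schanuel (h : _root_.Schanuel) :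
    FiniteOrderLiouvilleSchanuel :=
  fun n z hz _ _ => h n z hz

/-- **Exactness of the cut.** A₃ ⟺ A₄ʰ ∧ A₄ᵈ. -/
private theorem linLiouvilleSchanuel_iff_pieces₄ :
    LinLiouvilleSchanuel ↔ HyperLiouvilleSchanuel ∧ FiniteOrderLiouvilleSchanuel :=
  ⟨fun h => ⟨hyperLiouvilleSchanuel_of_linLiouvilleSchanuel h,
      finiteOrderLiouvilleSchanuel_of_linLiouvilleSchanuel h⟩,
    fun h => linLiouvilleSchanuel_of_pieces₄ h.1 h.2⟩

/-- **Exactness, round 4.** Schanuel ⟺ S_L′ ∧ A₄ʰ ∧ A₄ᵈ ∧ B₃. -/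
theorem schanuel_iff_pieces₄ :
    _root_.Schanuel ↔ CoordLiouvilleSchanuel ∧ HyperLiouvilleSchanuel ∧
      FiniteOrderLiouvilleSchanuel ∧ PolyDiophantineSchanuel :=
  ⟨fun h => ⟨coordLiouvilleSchanuel_of_schanuel h, hyperLiouvilleSchanuel_of_schanuel h,
      finiteOrderLiouvilleSchanuel_of_schanuel h, polyDiophantineSchanuel_of_schanuel h⟩,
    fun h => closes₅ h.1 h.2.1 h.2.2.1 h.2.2.2⟩

/-- The round-2 residual is exactly «A₄ʰ, A₄ᵈ on its scope» plus B₃. -/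
theorem strictDiophantineSchanuel_iff_pieces₄ :
    StrictDiophantineSchanuel ↔
      (∀ (n : ℕ) (z : Fin n → ℂ), LinearIndependent ℚ z → ¬ CoordLiouvilleSpan z →
          HyperLinLiouville z → SB n z) ∧
      (∀ (n : ℕ) (z : Fin n → ℂ), LinearIndependent ℚ z → ¬ CoordLiouvilleSpan z →
          LinLiouville z → ¬ HyperLinLiouville z → SB n z) ∧
      PolyDiophantineSchanuel := by
  constructor
  · intro h
    exact ⟨fun n z hz hD _ => h n z hz hD, fun n z hz hD _ _ => h n z hz hD,
      polyDiophantineSchanuel_of_strictDiophantineSchanuel h⟩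
  · rintro ⟨hH, hF, hB⟩ n z hz hD
    by_cases hL : LinLiouville z
    · by_cases hy : HyperLinLiouville z
      · exact hH n z hz hD hy
      · exact hF n z hz hD hL hy
    · exact hB n z hz hD hL

/-- **Cell `(ℓ, ℓ²)`, `ℓ` hyper-Liouville**: ℚ-free, in the scopes of S_L′ (31077), A₃ (31986)
AND A₄ʰ, and Schanuel's bound holds (mod `hX`, `e^ℓ` load-bearing: §16g). -/
theorem hyperCell_sq (hX : ExplicitRatExpApprox) {ℓ : ℝ} (hℓ : HyperLiouville ℓ) :
    LinearIndependent ℚ ![(ℓ : ℂ), (ℓ : ℂ) ^ 2] ∧ CoordLiouvilleSpan ![(ℓ : ℂ), (ℓ : ℂ) ^ 2] ∧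
      LinLiouville ![(ℓ : ℂ), (ℓ : ℂ) ^ 2] ∧ HyperLinLiouville ![(ℓ : ℂ), (ℓ : ℂ) ^ 2] ∧
      SB 2 ![(ℓ : ℂ), (ℓ : ℂ) ^ 2] :=
  have h := sb_hyperLiouville_sq hX hℓ
  ⟨h.1, h.2.1, h.2.2.1, hyperLinLiouville_sq hℓ, h.2.2.2⟩

/-- The `n = 2` instance of A₄ʰ at `(ℓ, ℓ²)` HOLDS (mod `hX`). -/
theorem hyperLiouvilleSchanuel_at_sq (hX : ExplicitRatExpApprox) {ℓ : ℝ} (hℓ : HyperLiouville ℓ) :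
    (2 : Cardinal) ≤ Algebra.trdeg ℚ ↥(IntermediateField.adjoin ℚ
      (Set.range ![(ℓ : ℂ), (ℓ : ℂ) ^ 2] ∪ Set.range (Complex.exp ∘ ![(ℓ : ℂ), (ℓ : ℂ) ^ 2]))) :=
  (sb_hyperLiouville_sq hX hℓ).2.2.2

/-- **Cell `(1, ℓ, w)`, any `w`, `ℓ` hyper-Liouville**: `HyperLinLiouville` and `SB 3` (mod `hX`;
`e`, `e^ℓ` load-bearing: §16g).  For `w ∉ ℚ + ℚℓ` a ℚ-free member of A₄ʰ's scope at `n = 3`. -/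
theorem hyperCell_one_any (hX : ExplicitRatExpApprox) {ℓ : ℝ} (hℓ : HyperLiouville ℓ) (w : ℂ) :
    HyperLinLiouville ![(1 : ℂ), (ℓ : ℂ), w] ∧ SB 3 ![(1 : ℂ), (ℓ : ℂ), w] :=
  ⟨hyperLinLiouville_one_any hℓ w, (sb_one_hyperLiouville_any hX hℓ w).1⟩

/-- **Cell «moment curve» `(ℓ, ℓ², …, ℓⁿ)`, `n ≥ 2`, `ℓ` hyper-Liouville**: ℚ-free, in the scopes
of 31077, A₃ and A₄ʰ at EVERY level, Schanuel's bound holds (mod `hX`; all `e^{ℓ^j}` load-bearing). -/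
theorem hyperCell_momentCurve (hX : ExplicitRatExpApprox) {ℓ : ℝ} (hℓ : HyperLiouville ℓ)
    {n : ℕ} (hn : 2 ≤ n) :
    LinearIndependent ℚ (fun i : Fin n => (ℓ : ℂ) ^ ((i : ℕ) + 1)) ∧
      CoordLiouvilleSpan (fun i : Fin n => (ℓ : ℂ) ^ ((i : ℕ) + 1)) ∧
      LinLiouville (fun i : Fin n => (ℓ : ℂ) ^ ((i : ℕ) + 1)) ∧
      HyperLinLiouville (fun i : Fin n => (ℓ : ℂ) ^ ((i : ℕ) + 1)) ∧
      SB n (fun i : Fin n => (ℓ : ℂ) ^ ((i : ℕ) + 1)) :=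
  have h := momentCurve_cell hX hℓ hn
  ⟨h.1, h.2.1, h.2.2.1, hyperLinLiouville_momentCurve hℓ hn, h.2.2.2⟩

/-- **THE EXPLICIT DECIDED TUPLE `(λ_H, λ_H²)`** (`λ_H = Σ_k 2^{−a_k}`, §17d): a NAMED ℚ-free tuple
in the scope of S_L′, of A₃ and of A₄ʰ, with Schanuel's bound PROVED (mod `hX`).  The round-4
shrink of A₃ is therefore witnessed by a named constant, not by a measure/category argument. -/
theorem lambdaH_sq_cell (hX : ExplicitRatExpApprox) :
    LinearIndependent ℚ ![(lambdaH : ℂ), (lambdaH : ℂ) ^ 2] ∧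
      CoordLiouvilleSpan ![(lambdaH : ℂ), (lambdaH : ℂ) ^ 2] ∧
      LinLiouville ![(lambdaH : ℂ), (lambdaH : ℂ) ^ 2] ∧
      HyperLinLiouville ![(lambdaH : ℂ), (lambdaH : ℂ) ^ 2] ∧
      SB 2 ![(lambdaH : ℂ), (lambdaH : ℂ) ^ 2] :=
  hyperCell_sq hX hyperLiouville_lambdaH

/-- … and the whole moment curve of `λ_H`, every level. -/
theorem lambdaH_momentCurve_cell (hX : ExplicitRatExpApprox) {n : ℕ} (hn : 2 ≤ n) :
    LinearIndependent ℚ (fun i : Fin n => (lambdaH : ℂ) ^ ((i : ℕ) + 1)) ∧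
      HyperLinLiouville (fun i : Fin n => (lambdaH : ℂ) ^ ((i : ℕ) + 1)) ∧
      SB n (fun i : Fin n => (lambdaH : ℂ) ^ ((i : ℕ) + 1)) :=
  have h := hyperCell_momentCurve hX hyperLiouville_lambdaH hn
  ⟨h.1, h.2.2.2.1, h.2.2.2.2⟩

/-- **THE NAMED FIRST OPEN CELL OF THE RESIDUAL A₄ᵈ: `(ℓ_b, ℓ_b²)`, `ℓ_b = liouvilleNumber b`
(`b ≥ 2`; Liouville's constant for `b = 10`).**  ℚ-free, in the scope of S_L′ (31077) and of A₃
(31986), `LinLiouville`, and NOT `HyperLinLiouville` (§17e: `ℓ_b` is not hyper-Liouville) — so it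
lies in A₄ᵈ's scope and OUTSIDE A₄ʰ's, hypothesis-free. -/
theorem liouvilleNumber_sq_cell {b : ℕ} (hb : 2 ≤ b) :
    LinearIndependent ℚ ![((liouvilleNumber b : ℝ) : ℂ), ((liouvilleNumber b : ℝ) : ℂ) ^ 2] ∧
      CoordLiouvilleSpan ![((liouvilleNumber b : ℝ) : ℂ), ((liouvilleNumber b : ℝ) : ℂ) ^ 2] ∧
      LinLiouville ![((liouvilleNumber b : ℝ) : ℂ), ((liouvilleNumber b : ℝ) : ℂ) ^ 2] ∧
      ¬ HyperLinLiouville ![((liouvilleNumber b : ℝ) : ℂ), ((liouvilleNumber b : ℝ) : ℂ) ^ 2] := by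
  set ℓ : ℝ := liouvilleNumber b with hℓdef
  have hL : Liouville ℓ := liouville_liouvilleNumber hb
  have hℓ0 : (ℓ : ℂ) ≠ 0 := Complex.ofReal_ne_zero.mpr hL.irrational.ne_zero
  have hz : LinearIndependent ℚ ![(ℓ : ℂ), (ℓ : ℂ) * ℓ] :=
    linearIndependent_pair_of_irrational hℓ0 hL.irrational
  rw [sq]
  refine ⟨hz, ?_, linLiouville_of_liouville_ratio hL (ℓ : ℂ),
    not_hyperLinLiouville_of_ratio_not_hyperLiouville (not_hyperLiouville_liouvilleNumber hb) hz⟩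
  exact ⟨(ℓ : ℂ), Submodule.subset_span ⟨0, by simp⟩, Or.inl (by simpa using hL)⟩

/-- A₄ᵈ AT ITS NAMED CELL = Schanuel's bound at `(ℓ_b, ℓ_b²)` (the hypotheses of A₄ᵈ are MET
there, hypothesis-free); A₄ʰ is SILENT there (its hypothesis `HyperLinLiouville` FAILS). -/
theorem finiteOrderLiouvilleSchanuel_at_liouvilleNumber_sq (hF : FiniteOrderLiouvilleSchanuel)
    {b : ℕ} (hb : 2 ≤ b) :
    SB 2 ![((liouvilleNumber b : ℝ) : ℂ), ((liouvilleNumber b : ℝ) : ℂ) ^ 2] :=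
  have h := liouvilleNumber_sq_cell hb
  hF 2 _ h.1 h.2.2.1 h.2.2.2

/-- What would DECIDE the named cell: `ℓ_b` and `e^{ℓ_b}` algebraically independent (then
`trdeg ℚ(ℓ_b, ℓ_b², e^{ℓ_b}, e^{ℓ_b²}) ≥ 2`).  Round 4's extraction gives this for HYPER-Liouville
`ℓ` mod `hX` (§16); for `ℓ_b` (approximations of polynomial order `q^{−(k+1)}` only at
`q = b^{k!}`) it would need an approximation measure for `e^{p/q}` POLYNOMIAL in `q` at FIXED
degree/height of the approximant — a Baker-type inhomogeneous bound `|p − q·log ξ| ≥ (qH)^{−c(n)}`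
with the heights entering as a SUM, i.e. of Lang–Waldschmidt shape; open (IDEA-NEEDED leaf). -/
theorem sb_liouvilleNumber_sq_of_algebraicIndependent {b : ℕ}
    (hai : AlgebraicIndependent ℚ ![((liouvilleNumber b : ℝ) : ℂ), cexp (liouvilleNumber b : ℝ)]) :
    SB 2 ![((liouvilleNumber b : ℝ) : ℂ), ((liouvilleNumber b : ℝ) : ℂ) ^ 2] :=
  sb_two_of_algebraicIndependent_exp 0 (by simpa using hai)

/-- **Scope of A₄ʰ beyond the decided cells (non-vacuity of the dark side):** for every
hyper-Liouville `ρ` and every `t ≠ 0` the pair `(t, ρt)` is ℚ-free and `HyperLinLiouville`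
(e.g. `t = Ω` with `Ω e^Ω = 1`, `ρ = λ_H`: a dark hyper pair, §17h). -/
theorem hyperPair_scope {t : ℂ} (ht : t ≠ 0) {ρ : ℝ} (hρ : HyperLiouville ρ) :
    LinearIndependent ℚ ![t, (ρ : ℂ) * t] ∧ HyperLinLiouville ![t, (ρ : ℂ) * t] :=
  ⟨linearIndependent_pair_of_irrational ht hρ.irrational, hyperLinLiouville_of_hyperLiouville_ratio hρ t⟩

/-- **Fail-alone worlds.** A₄ʰ is silent on `(ℓ_b, ℓ_b²)` (not hyper) and on the flagships
`(1, iπ)` (not even `LinLiouville`, hypothesis-free) and `(1, e)` (mod NW); A₄ᵈ is silent on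
`(λ_H, λ_H²)` (hyper) and on the flagships; B₃ is silent on both named cells (they ARE
`LinLiouville`).  So no piece is vacuous and none implies Schanuel by restriction of scope. -/
theorem failAlone_worlds₄ :
    ¬ HyperLinLiouville ![((liouvilleNumber 10 : ℝ) : ℂ), ((liouvilleNumber 10 : ℝ) : ℂ) ^ 2] ∧
      HyperLinLiouville ![(lambdaH : ℂ), (lambdaH : ℂ) ^ 2] ∧
      LinLiouville ![((liouvilleNumber 10 : ℝ) : ℂ), ((liouvilleNumber 10 : ℝ) : ℂ) ^ 2] ∧
      LinLiouville ![(lambdaH : ℂ), (lambdaH : ℂ) ^ 2] ∧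
      ¬ HyperLinLiouville ![(1 : ℂ), (Real.pi : ℂ) * I] ∧
      ¬ LinLiouville ![(1 : ℂ), (Real.pi : ℂ) * I] :=
  ⟨(liouvilleNumber_sq_cell (by norm_num)).2.2.2, hyperLinLiouville_sq hyperLiouville_lambdaH,
    (liouvilleNumber_sq_cell (by norm_num)).2.2.1,
    (hyperLinLiouville_sq hyperLiouville_lambdaH).linLiouville,
    fun h => not_linLiouville_one_pi_I h.linLiouville, not_linLiouville_one_pi_I⟩

/-- **Weak (sub-exponential) transcendence measure in every degree**: for each `d` there are
`C > 0`, `k` with `|P(θ)| ≥ exp(−C · (len P)^k)` for all non-zero integer `P` of degree `≤ d`.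
Implied by `PolyMeasure` (§7) and by every finite transcendence type in Lang's sense
(`|P(θ)| ≥ exp(−C (deg P + log H(P))^τ)`, the tree's `HasTranscendenceType`,
`Theorems/DiophantineDichotomyDefs.lean`), since `log len P ≤ len P`. -/
def WeakMeasure (θ : ℂ) : Prop :=
  ∀ d : ℕ, ∃ (C : ℝ) (k : ℕ), 0 < C ∧ ∀ P : ℤ[X], P ≠ 0 → P.natDegree ≤ d →
    Real.exp (-(C * ((len P : ℤ) : ℝ) ^ k)) ≤ ‖aeval θ P‖

/-- §17h. WHY A₄ʰ IS STRICTLY MORE ATTACKABLE THAN A₃: hyper-Liouville extraction against a: auxiliary statement `aeval_ne_zero_of_weakMeasure` (lens 6 gen 9 node, ported verbatim). -/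
theorem aeval_ne_zero_of_weakMeasure {θ : ℂ} (hθ : WeakMeasure θ) {P : ℤ[X]} (hP : P ≠ 0) :
    aeval θ P ≠ 0 := by
  intro h0
  obtain ⟨C, k, _, h⟩ := hθ P.natDegree
  have h1 := h P hP le_rfl
  rw [h0, norm_zero] at h1
  exact absurd h1 (not_le.mpr (Real.exp_pos _))

/-- §17h. WHY A₄ʰ IS STRICTLY MORE ATTACKABLE THAN A₃: hyper-Liouville extraction against a: auxiliary statement `transcendental_of_weakMeasure` (lens 6 gen 9 node, ported verbatim). -/
theorem transcendental_of_weakMeasure {θ : ℂ} (hθ : WeakMeasure θ) : Transcendental ℚ θ := by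
  intro halg
  obtain ⟨P, hP0, hP⟩ := (IsFractionRing.isAlgebraic_iff ℤ ℚ ℂ).mpr halg
  exact aeval_ne_zero_of_weakMeasure hθ hP0 hP

/-- `PolyMeasure ⇒ WeakMeasure` (`(C·L^τ)⁻¹ ≥ exp(−C·L^τ)` as `C·L^τ ≥ 1`). -/
theorem PolyMeasure.weakMeasure {θ : ℂ} (hθ : PolyMeasure θ) : WeakMeasure θ := by
  intro d
  obtain ⟨C, τ, hC, h⟩ := hθ d
  refine ⟨C, τ, hC, fun P hP hdeg => ?_⟩
  have h1 := h P hP hdeg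
  have hL1 : (1 : ℝ) ≤ ((len P : ℤ) : ℝ) := by exact_mod_cast one_le_len hP
  have hy : 0 < C * ((len P : ℤ) : ℝ) ^ τ := by positivity
  have h2 : (C * ((len P : ℤ) : ℝ) ^ τ)⁻¹ ≤ ‖aeval θ P‖ := by
    rw [inv_le_iff_one_le_mul₀ hy]; linarith [h1]
  calc Real.exp (-(C * ((len P : ℤ) : ℝ) ^ τ)) ≤ 1 / (C * ((len P : ℤ) : ℝ) ^ τ) :=
        exp_neg_le_one_div hy
    _ = (C * ((len P : ℤ) : ℝ) ^ τ)⁻¹ := one_div _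
    _ ≤ ‖aeval θ P‖ := h2

end HyperCell

end Summit.Schanuel.Schanuel.Theorems.RootDecomp1KHyper
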